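import Summits.HodgeConjecture.HodgeConjecture.Theorems.F0P2mHdictEOfLetter
import Summits.HodgeConjecture.HodgeConjecture.Theorems.F0P2oCSharpHolOfLetters
import Summits.HodgeConjecture.HodgeConjecture.Theorems.F0P2NodeBFinComponentHolds
import Summits.HodgeConjecture.HodgeConjecture.Theorems.F0P2oCinfArchTypeAtHolds
import Summits.HodgeConjecture.HodgeConjecture.Theorems.F0P2oCcArchTypeAwayHolds
import Summits.HodgeConjecture.HodgeConjecture.Theorems.F0FloorSockets
import HarnessLib

/-!
# Crux `H413`, programme P2 — ROAD I OF THE END-GAME AS NAMED CONSTANTS: socket 27455 `F0HdictE`, #87 (C♯)hol and E3♭ from the ONE print letter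
# #113 D1 `Liu2021.cohHol_meetsThetaLiftFromLine` (desk F0P2-plan (g10) brief P2-B1; the HOME cert `CERT-P2-endgame.F0P2-plan-g10.lean` 475b9d62883fdc1c made tree)

Cell hodgecm-mathlib (D-0151), FLOOR 0, crux item H413 = stmt-HodgeConjecture-24833, socket item 27455 `HCCMUnconditional.F0HdictE`; programme P2 (theta ∕ `hdictE`).
Author F0P2-p01 (g10).  THEOREMS ONLY (no `def`, no instance, no notation, no named fact introduced, no `sorry`); `--supports stmt-HodgeConjecture-27455 --as helper`;
imports Theorems only (never a `Cruxes/…/Lines` module).  CONDITIONAL on exactly ONE print letter, taken BY NAME as the hypothesis `hD1 :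
Liu2021.cohHol_meetsThetaLiftFromLine` (#113 D1, THETA EXHAUSTION: a holomorphic `H¹`-cohomological discrete automorphic representation of the anisotropic `U(H)`
IS a global theta lift from a hermitian line [Liu2021, proof of Prop. 4.13 Case 1 via Thm. B.4 ∕ Cor. B.5–B.6; GelbartRogawski1991, Thm. 5.1.1]) — everything
else on road I is ★ hypothesis-free (node B ★ p831362 `meetsThetaLiftFromLine_hasFinComponent_rhoAtLine_holds`, C∞ ★ p838562
`meetsThetaLiftFromLine_hol_archTypeAt_holds`, Cc ★ p836451 `meetsThetaLiftFromLine_hol_archTypeAway_holds`, the (C♯)hol assembler ★ `cSharpHol_of_letters`, the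
socket assembler ★ `hdictE_of_cohFinComponent_isThetaSigned`, the E3♭ vehicles ★ `e3flatArch_of_cohFinComponent_isThetaSigned` ∕ ★ `e3flat_of_arch`).
PURPOSE (PLAN-P2.v10 §4 P2-B1): NAMED CONSTANTS for the D1-day one-token folds — T5a :81 ∕ E3Rung3 :596 ∕ E3ParityRecut :260 ∕ the (C)-line registry stub on
27455 ∕ the registrar's `A3Liu413.stub_oscillatorTriple_dictionaryExistence` — each becomes `F0P2qHdictEOfD1.<head> ‹D1 constant›` (the E3♭∞ ∕ E3♭ sites through
the ★ vehicles: `e3flatArch_of_cohFinComponent_isThetaSigned (cSharpHol_of_D1 ‹D1›)` ∕ `e3flat_of_arch (…)`).  Count effect: 0.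

HONEST LABEL (D-0151): «HC_CM is proved only modulo the printed citations until rung 0 closes» — this file proves NO letter; it records that P2's
release residue on road I is EXACTLY {#113}.

## References
* [Liu2021] Y. Liu, *Fourier–Jacobi cycles and arithmetic relative trace formula*, Camb. J. Math. 9 (2021) = arXiv:2102.11518: Prop. 4.13, proof Case 1
  (l. 2131–2145); App. B Thm. B.4, Cor. B.5, Cor. B.6 (1); App. D Lem. D.2.
* [Rogawski1990] J. Rogawski, Ann. of Math. Stud. 123 (1990): Thm. 13.3.6 (c); §15.3 ¶1 p. 244.
* [GelbartRogawski1991] S. Gelbart, J. Rogawski, Invent. Math. 105 (1991): Thm. 5.1.1; Lem. 5.1.2 p. 466.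
* [BergeronMillsonMoeglin2016Balls] N. Bergeron, J. Millson, C. Mœglin, *The Hodge conjecture and arithmetic quotients of complex balls*, Acta Math. 216
  (2016): Prop. 13.4.
-/

set_option autoImplicit false
-- the mandated namespace has the single-problem summit's repeated segment (`HodgeConjecture.HodgeConjecture`)
set_option linter.dupNamespace false

noncomputable section

namespace Summit.HodgeConjecture.HodgeConjecture.Cruxes.H413.F0P2qHdictEOfD1

open Summit.HodgeConjecture.HodgeConjecture.Cruxes.H413

/-! ## §1 Road I: #87 (C♯)hol and socket 27455 from #113 D1 alone -/

set_option synthInstance.maxHeartbeats 400000 in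
set_option maxHeartbeats 8000000 in
/-- **#87 (C♯)hol ⟸ #113 D1 ALONE**: the engine letter ★ `Rogawski1990.cohFinComponent_isThetaSigned_hol` from the D1 theta-exhaustion letter, over the
hypothesis-free nodes B ★ p831362, C∞ ★ p838562, Cc ★ p836451 (★ `F0P2oCSharpHolOfLetters.cSharpHol_of_letters`).
[cite: Liu2021, proof of Prop. 4.13 Case 1 (l. 2131–2145); App. D Lem. D.2] [cite: GelbartRogawski1991, Thm. 5.1.1; Lem. 5.1.2 p. 466] [cite: Rogawski1990, Thm. 13.3.6 (c)] -/
theorem cSharpHol_of_D1 (hD1 : Literature.NumberTheory.Automorphic.Liu2021.cohHol_meetsThetaLiftFromLine) :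
    Literature.NumberTheory.Rogawski1990.cohFinComponent_isThetaSigned_hol :=
  F0P2oCSharpHolOfLetters.cSharpHol_of_letters hD1
    F0P2NodeBFinComponentHolds.meetsThetaLiftFromLine_hasFinComponent_rhoAtLine_holds
    F0P2oCinfArchTypeAtHolds.meetsThetaLiftFromLine_hol_archTypeAt_holds
    F0P2oCcArchTypeAwayHolds.meetsThetaLiftFromLine_hol_archTypeAway_holds

set_option synthInstance.maxHeartbeats 400000 in
set_option maxHeartbeats 8000000 in
/-- **SOCKET 27455 AT ITS THEOREMS-SIDE TYPE `F0FloorSockets.HdictEType` ⟸ #113 D1 ALONE** (★ `F0P2mHdictEOfLetter.hdictE_of_cohFinComponent_isThetaSigned` over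
§1's (C♯)hol; `HCCMUnconditional.F0HdictE := HdictEType`, one δ-step, so this is also the route socket BY NAME — stated Theses-free to stay out of the
route cone).  The D1-day closer of the socket item and the registrar's fold token of `A3Liu413.stub_oscillatorTriple_dictionaryExistence` (body = `HdictEType`
body verbatim) are both `hdictEType_of_D1 ‹the D1 constant›`.
[cite: Liu2021, Prop. 4.13; proof Case 1 (l. 2131–2145); App. D Lem. D.2] [cite: Rogawski1990, Thm. 13.3.6 (c); §15.3 ¶1 p. 244] [cite: GelbartRogawski1991, Thm. 5.1.1] -/
theorem hdictEType_of_D1 (hD1 : Literature.NumberTheory.Automorphic.Liu2021.cohHol_meetsThetaLiftFromLine) :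
    Summit.HodgeConjecture.HodgeConjecture.Theorems.F0FloorSockets.HdictEType :=
  F0P2mHdictEOfLetter.hdictE_of_cohFinComponent_isThetaSigned (cSharpHol_of_D1 hD1)

end Summit.HodgeConjecture.HodgeConjecture.Cruxes.H413.F0P2qHdictEOfD1

end
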